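import Summits.BirchSwinnertonDyer.BirchSwinnertonDyer.Theorems.ThetaPartnerAtTwoSignedKatoUpToAtTwoOfPubInv
import Summits.BirchSwinnertonDyer.BirchSwinnertonDyer.Theorems.ThetaPartnerAtTwoSignedKatoUpToAtTwoPointsPackageTransfer
import Summits.BirchSwinnertonDyer.BirchSwinnertonDyer.Theorems.ThetaPartnerAtTwoSignedKatoUpToAtTwoH1SideOfLayerPairings
import Summits.BirchSwinnertonDyer.BirchSwinnertonDyer.Theses.ResidualThetaTransportAtTwo
import HarnessLib

/-!
# Route `ThetaPartnerAtTwo` (TP2) / `ResidualThetaTransportAtTwo` (RTT), crux K3 `SignedKatoDivisibilityUpToAtTwo`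
# (item stmt-BirchSwinnertonDyer-20308), line `colemanrat` v6 — THE END-TO-END CERTIFICATE:
# K3 BY NAME ⟸ {print-exact Kato 13.4 (2) at 2, Gross–Zagier–Kolyvagin} + the LAYER residue (D-layer ∧ PT-layer ∧ ERL-layer)

Width seat `bsd-wall-tp2-p2x-w2` g3 (cell `bsd-wall`). HONEST FRAMING: THEOREMS ONLY — no definition, no named fact, no instance, no
`sorry`; CONDITIONAL on the displayed hypotheses (two named facts + one research residue); closes no item (`proof.conditional`);
BSD is NOT proved by any of this.

## What is proved

`signedKatoDivisibilityUpToAtTwo_of_contraFact_of_gzk_of_layerPairings` (TP2 decl) and `…_rtt` (RTT decl, same body): K3 by name from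
* the Literature named fact `Kato2004.thm13_4_two_lengthAt_fineSelmerDualContra_le_of_isEulerSystemClassTwo` (Kato Thm. 13.4 (2) at `p = 2`,
  print-exact contragredient spelling, typer p599770),
* `rank_eq_analyticRank_of_analyticRank_le_one` (GZK, a route binder),
* the research residue of the line READ AT FINITE LEVEL — the hypothesis of `H1SideOfLayerPairings.h1SideTwoInv_of_layerPairings`
  (per `v ∋ 2`, habitat datum, height-one `𝔭 ∌ 2`: a local lift `g`, a plus Honda system `d`, the pinned `I`, `ℤ₂`-linear LAYER pairings
  `H¹(ℚ_n, T₂E) → Hom(E(ℚ_n·ℚ_v), ℤ₂)` with (P1) projection formula and (P2) invariance, (PT-layer) orthogonality up to `2^m` on Kummer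
  witnesses, (ES) a genuine class, (ERL-layer) its ♭-Coleman values bounded by `L♭` at `𝔭`),
by composing the kernel chain: `h1SideTwoInv_of_layerPairings` (w2 g3, p602595) → `localRobustPackageTwoInv_of_h1SideTwoInv` (lead g4,
p601055: R2b → R2^ι) → `IwasawaInvolution.signedKatoDivisibilityUpToAtTwo_of_contraFact_of_gzk_of_packageInv` (w3 g3, p600818: K2′ fact +
GZK + R2^ι → K3 via `stub_involChainTwo` and `signedKatoDivisibilityUpToAtTwo_of_offTwo`). This is the line's composition with every
kernel piece discharged and exactly the research residue + the two PUB facts left as hypotheses.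

References: [Kato2004Asterisque] Thm. 12.5, Thm. 13.4 (2), §17.13; [Kobayashi2003] Thm. 1.3 (i), Thm. 6.2–6.3, (7.17)–(7.21);
[Sprung2012] Def. 5.9, Def. 6.1, §7; [GrossZagier1986] Thm. I.6.3; [Kolyvagin1990] Thm. A.
-/

set_option autoImplicit false
-- the Theorems namespace of this sub repeats the summit name by design (D-0017 nested layout)
set_option linter.dupNamespace false

noncomputable section

open scoped Classical MatrixGroups ModularForm NumberField

namespace Summit.BirchSwinnertonDyer.BirchSwinnertonDyer.Theorems

namespace SignedKatoOffTwo.H1SideOfLayerPairings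

open CongruenceSubgroup WeierstrassCurve Field IsDedekindDomain NumberField
  Literature.NumberTheory.GaloisRepresentations
  Literature.NumberTheory.EllipticCurves Literature.NumberTheory.EllipticCurves.ModularForms
  Literature.NumberTheory.EllipticCurves.Module Literature.NumberTheory.EllipticCurves.Rank1Residual
  Literature.NumberTheory.EllipticCurves.Kobayashi2003 Literature.NumberTheory.EllipticCurves.Kato2004
  Literature.NumberTheory.EllipticCurves.Kato2004.EulerSystemValues Literature.NumberTheory.EllipticCurves.GreenbergSelmer
  Literature.NumberTheory.EllipticCurves.Sprung2012
  ZpExtension Summit.BirchSwinnertonDyer.Rank1Residual.Supersingular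

/-- **K3 `SignedKatoDivisibilityUpToAtTwo` (TP2 decl) BY NAME from {Kato 13.4 (2) at 2 print-exact, GZK} + the LAYER residue** —
the composition of the line `colemanrat` v6 with every kernel piece discharged: layer pairings ⇒ (R2b) (`h1SideTwoInv_of_layerPairings`)
⇒ (R2^ι) (`localRobustPackageTwoInv_of_h1SideTwoInv`) ⇒ K3 (`signedKatoDivisibilityUpToAtTwo_of_contraFact_of_gzk_of_packageInv`,
i.e. `stub_involChainTwo` + `katoBoundTwoInv_of_contra` + `signedKatoDivisibilityUpToAtTwo_of_offTwo`). CONDITIONAL (two named facts,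
one research residue). [cite: Kato2004Asterisque, Thm. 13.4 (2) (p. 226), §17.13 (p. 279)] [cite: Kobayashi2003, Thm. 1.3 (i) (p. 2), Thm. 6.2–6.3 (p. 11)]
[cite: Sprung2012, Def. 6.1 (p. 1495)] [cite: GrossZagier1986, Thm. I.6.3] [cite: Kolyvagin1990, Thm. A] -/
theorem signedKatoDivisibilityUpToAtTwo_of_contraFact_of_gzk_of_layerPairings
    (hK2 : Kato2004.thm13_4_two_lengthAt_fineSelmerDualContra_le_of_isEulerSystemClassTwo)
    (hGZK : rank_eq_analyticRank_of_analyticRank_le_one)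
    (H :
      ∀ (v : HeightOneSpectrum (𝓞 ℚ)), ((2 : ℕ) : 𝓞 ℚ) ∈ v.asIdeal →
      ∀ (W : WeierstrassCurve ℚ) [W.IsElliptic] [W.IsGloballyMinimal],
        ¬ W.HasCM → W.analyticRank = 0 → GoodSS W 2 → W.frobeniusTrace 2 = 0 →
        ∀ (κ : ZpExtension ℚ 2) (γ : Field.absoluteGaloisGroup ℚ) (hκ : κ.IsCyclotomic),
          κ.IsTopGenerator γ → IsCyclotomicVariable 2 γ →
          ∀ [NeZero (W.conductorNorm ℤ)] (f : CuspForm (Gamma0 (W.conductorNorm ℤ)) 2),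
            IsNewformOf W f → ∀ (ϖ : ℚ), (ϖ : ℝ) * W.realPeriodRat = plusPeriod f →
          ∀ (Lplus Lminus : IwasawaAlgebra 2), IsPollackPair f 2 Lplus Lminus →
          ∀ [ContinuousSMul ℤ_[2] (W.tateModule 2)] [Module.Free ℤ_[2] (W.tateModule 2)]
            [Module.Finite ℤ_[2] (W.tateModule 2)],
          ∀ 𝔭 : PrimeSpectrum (IwasawaAlgebra 2), 𝔭.asIdeal.height = 1 →
            PowerSeries.C (2 : ℤ_[2]) ∉ 𝔭.asIdeal →
          ∃ (g : absoluteGaloisGroup (v.adicCompletion ℚ))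
            (_ : κ.IsTopGenerator (resGalOfEmb (closureEmb (K := ℚ) (v.adicCompletion ℚ)) g))
            (d : ℕ → localPoints W (v.adicCompletion ℚ))
            (I : Kato2004.IwasawaH1Data W 2 κ γ)
            (pair : ∀ n : ℕ, H1 (tateRep W 2) (κ.layerSubgroup n) →ₗ[ℤ_[2]]
              (localLayerPointsOfEmb κ (closureEmb (K := ℚ) (v.adicCompletion ℚ)) W n →+ ℤ_[2]))
            (s : I.H) (m : ℕ),
            -- the plus Honda system at `v`: (L), (TR), (GEN), (GEN₀) (verbatim as in (R2b); HONDA⁺@2 is a tree theorem)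
            (∀ n, d n ∈ localLayerPointsOfEmb κ (closureEmb (K := ℚ) (v.adicCompletion ℚ)) W n) ∧
            (∀ n, localTraceOfEmb κ (closureEmb (K := ℚ) (v.adicCompletion ℚ)) W (n + 1) (n + 2) (d (n + 2)) = -d n) ∧
            (∀ n : ℕ, 1 ≤ n → ∀ P ∈ localLayerPointsOfEmb κ (closureEmb (K := ℚ) (v.adicCompletion ℚ)) W n,
              ∃ B ∈ AddSubgroup.closure (Set.range fun σ : absoluteGaloisGroup (v.adicCompletion ℚ) ↦ σ • d n),
                ∃ P' ∈ localLayerPointsOfEmb κ (closureEmb (K := ℚ) (v.adicCompletion ℚ)) W (n - 1),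
                ∃ R ∈ localLayerPointsOfEmb κ (closureEmb (K := ℚ) (v.adicCompletion ℚ)) W n, P = B + P' + 2 • R) ∧
            (∀ P ∈ localLayerPointsOfEmb κ (closureEmb (K := ℚ) (v.adicCompletion ℚ)) W 0,
              ∃ a : ℤ, ∃ R ∈ localLayerPointsOfEmb κ (closureEmb (K := ℚ) (v.adicCompletion ℚ)) W 0, P = a • d 0 + 2 • R) ∧
            -- (P1) projection formula of the LAYER pairings
            (∀ (n : ℕ) (x : H1 (tateRep W 2) (κ.layerSubgroup (n + 1))) (Q : localPoints W (v.adicCompletion ℚ))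
              (hQ : Q ∈ localLayerPointsOfEmb κ (closureEmb (K := ℚ) (v.adicCompletion ℚ)) W n),
              pair n (layerCores (tateRep W 2) κ n x) ⟨Q, hQ⟩ =
                pair (n + 1) x ⟨Q, localLayerPointsOfEmb_mono κ _ W (Nat.le_succ n) hQ⟩) ∧
            -- (P2) Galois invariance for `g`
            (∀ (n : ℕ) (y : H1 (tateRep W 2) (κ.layerSubgroup n)) (Q : localPoints W (v.adicCompletion ℚ))
              (hQ : Q ∈ localLayerPointsOfEmb κ (closureEmb (K := ℚ) (v.adicCompletion ℚ)) W n),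
              pair n (conjMap (tateRep W 2).toTopRep (κ.layerSubgroup n) (resGalOfEmb (closureEmb (K := ℚ) (v.adicCompletion ℚ)) g) 1 y)
                ⟨g • Q, smul_mem_localLayerPointsOfEmb κ _ W n g hQ⟩ = pair n y ⟨Q, hQ⟩) ∧
            -- (PT) orthogonality up to `2^m` on the Kummer witnesses of `Sel⁺(E/ℚ_∞)` (Poitou–Tate along `ℚ_∞`), per layer
            (∀ (x : I.H) (t : W.subgroupH1 2 κ.kerSubgroup), t ∈ signedSelmerInfty W κ 1 →
              ∀ (φ : contOneCocycles (discreteTopRep κ.kerSubgroup (W.geomPrimaryTorsion 2)))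
                (Q : localPoints W (v.adicCompletion ℚ)) (k : ℕ), oneCocycleClass _ φ = t →
                2 ^ k • Q ∈ (⨆ n, signedLocalPoints κ (v.adicCompletion ℚ) W 1 n) →
                (∀ τ : localSubgroupOfEmb κ.kerSubgroup (closureEmb (K := ℚ) (v.adicCompletion ℚ)),
                  pointsMapOfEmb W (closureEmb (K := ℚ) (v.adicCompletion ℚ))
                      ((φ.1 (resGalSubgroupOfEmb κ.kerSubgroup _ τ) : W.geomPrimaryTorsion 2) : W.geomPoints) =
                    (τ : absoluteGaloisGroup (v.adicCompletion ℚ)) • Q - Q) →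
                ∀ (n : ℕ) (hQn : 2 ^ k • Q ∈ localLayerPointsOfEmb κ (closureEmb (K := ℚ) (v.adicCompletion ℚ)) W n),
                  PadicInt.toZModPow k ((2 : ℤ_[2]) ^ m * pair n (I.proj n x) ⟨2 ^ k • Q, hQn⟩) = 0) ∧
            -- (ES) a genuine `2`-adic Euler-system class
            Kato2004.IsEulerSystemClassTwo W hκ I s ∧
            -- (ERL♭) per layer: every functional glued from `⟨proj n s, ·⟩_n` has its ♭-Coleman values bounded by `L♭` at `𝔭`
            (∀ (z : localTowerPointsOfEmb κ (closureEmb (K := ℚ) (v.adicCompletion ℚ)) W →+ ℤ_[2]),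
              (∀ (n : ℕ) (Q : localPoints W (v.adicCompletion ℚ)) (hQ : Q ∈ localLayerPointsOfEmb κ (closureEmb (K := ℚ) (v.adicCompletion ℚ)) W n),
                z ⟨Q, localLayerPointsOfEmb_le_localTowerPointsOfEmb κ _ W n hQ⟩ = pair n (I.proj n s) ⟨Q, hQ⟩) →
              ∀ Ls Lf : IwasawaAlgebra 2, IsColemanPair κ (closureEmb (K := ℚ) (v.adicCompletion ℚ)) W 0 g d z Ls Lf →
                lengthAt (IwasawaAlgebra 2) (IwasawaAlgebra 2 ⧸ Ideal.span {Lf}) 𝔭 ≤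
                  lengthAt (IwasawaAlgebra 2) (IwasawaAlgebra 2 ⧸ Ideal.span {kobayashiL 1 Lplus Lminus}) 𝔭)) :
    Summit.BirchSwinnertonDyer.BirchSwinnertonDyer.Theses.ThetaPartnerAtTwo.SignedKatoDivisibilityUpToAtTwo :=
  IwasawaInvolution.signedKatoDivisibilityUpToAtTwo_of_contraFact_of_gzk_of_packageInv hK2 hGZK
    (localRobustPackageTwoInv_of_h1SideTwoInv (h1SideTwoInv_of_layerPairings H))

/-- The same certificate concluding the RTT route's copy of K3 (`Theses.ResidualThetaTransportAtTwo.SignedKatoDivisibilityUpToAtTwo`,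
byte-identical body, so the TP2 proof term is accepted by unfolding). [cite: Kato2004Asterisque, Thm. 13.4 (2) (p. 226)]
[cite: Kobayashi2003, Thm. 1.3 (i) (p. 2)] -/
theorem signedKatoDivisibilityUpToAtTwo_of_contraFact_of_gzk_of_layerPairings_rtt
    (hK2 : Kato2004.thm13_4_two_lengthAt_fineSelmerDualContra_le_of_isEulerSystemClassTwo)
    (hGZK : rank_eq_analyticRank_of_analyticRank_le_one)
    (H :
      ∀ (v : HeightOneSpectrum (𝓞 ℚ)), ((2 : ℕ) : 𝓞 ℚ) ∈ v.asIdeal →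
      ∀ (W : WeierstrassCurve ℚ) [W.IsElliptic] [W.IsGloballyMinimal],
        ¬ W.HasCM → W.analyticRank = 0 → GoodSS W 2 → W.frobeniusTrace 2 = 0 →
        ∀ (κ : ZpExtension ℚ 2) (γ : Field.absoluteGaloisGroup ℚ) (hκ : κ.IsCyclotomic),
          κ.IsTopGenerator γ → IsCyclotomicVariable 2 γ →
          ∀ [NeZero (W.conductorNorm ℤ)] (f : CuspForm (Gamma0 (W.conductorNorm ℤ)) 2),
            IsNewformOf W f → ∀ (ϖ : ℚ), (ϖ : ℝ) * W.realPeriodRat = plusPeriod f →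
          ∀ (Lplus Lminus : IwasawaAlgebra 2), IsPollackPair f 2 Lplus Lminus →
          ∀ [ContinuousSMul ℤ_[2] (W.tateModule 2)] [Module.Free ℤ_[2] (W.tateModule 2)]
            [Module.Finite ℤ_[2] (W.tateModule 2)],
          ∀ 𝔭 : PrimeSpectrum (IwasawaAlgebra 2), 𝔭.asIdeal.height = 1 →
            PowerSeries.C (2 : ℤ_[2]) ∉ 𝔭.asIdeal →
          ∃ (g : absoluteGaloisGroup (v.adicCompletion ℚ))
            (_ : κ.IsTopGenerator (resGalOfEmb (closureEmb (K := ℚ) (v.adicCompletion ℚ)) g))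
            (d : ℕ → localPoints W (v.adicCompletion ℚ))
            (I : Kato2004.IwasawaH1Data W 2 κ γ)
            (pair : ∀ n : ℕ, H1 (tateRep W 2) (κ.layerSubgroup n) →ₗ[ℤ_[2]]
              (localLayerPointsOfEmb κ (closureEmb (K := ℚ) (v.adicCompletion ℚ)) W n →+ ℤ_[2]))
            (s : I.H) (m : ℕ),
            -- the plus Honda system at `v`: (L), (TR), (GEN), (GEN₀) (verbatim as in (R2b); HONDA⁺@2 is a tree theorem)
            (∀ n, d n ∈ localLayerPointsOfEmb κ (closureEmb (K := ℚ) (v.adicCompletion ℚ)) W n) ∧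
            (∀ n, localTraceOfEmb κ (closureEmb (K := ℚ) (v.adicCompletion ℚ)) W (n + 1) (n + 2) (d (n + 2)) = -d n) ∧
            (∀ n : ℕ, 1 ≤ n → ∀ P ∈ localLayerPointsOfEmb κ (closureEmb (K := ℚ) (v.adicCompletion ℚ)) W n,
              ∃ B ∈ AddSubgroup.closure (Set.range fun σ : absoluteGaloisGroup (v.adicCompletion ℚ) ↦ σ • d n),
                ∃ P' ∈ localLayerPointsOfEmb κ (closureEmb (K := ℚ) (v.adicCompletion ℚ)) W (n - 1),
                ∃ R ∈ localLayerPointsOfEmb κ (closureEmb (K := ℚ) (v.adicCompletion ℚ)) W n, P = B + P' + 2 • R) ∧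
            (∀ P ∈ localLayerPointsOfEmb κ (closureEmb (K := ℚ) (v.adicCompletion ℚ)) W 0,
              ∃ a : ℤ, ∃ R ∈ localLayerPointsOfEmb κ (closureEmb (K := ℚ) (v.adicCompletion ℚ)) W 0, P = a • d 0 + 2 • R) ∧
            -- (P1) projection formula of the LAYER pairings
            (∀ (n : ℕ) (x : H1 (tateRep W 2) (κ.layerSubgroup (n + 1))) (Q : localPoints W (v.adicCompletion ℚ))
              (hQ : Q ∈ localLayerPointsOfEmb κ (closureEmb (K := ℚ) (v.adicCompletion ℚ)) W n),
              pair n (layerCores (tateRep W 2) κ n x) ⟨Q, hQ⟩ =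
                pair (n + 1) x ⟨Q, localLayerPointsOfEmb_mono κ _ W (Nat.le_succ n) hQ⟩) ∧
            -- (P2) Galois invariance for `g`
            (∀ (n : ℕ) (y : H1 (tateRep W 2) (κ.layerSubgroup n)) (Q : localPoints W (v.adicCompletion ℚ))
              (hQ : Q ∈ localLayerPointsOfEmb κ (closureEmb (K := ℚ) (v.adicCompletion ℚ)) W n),
              pair n (conjMap (tateRep W 2).toTopRep (κ.layerSubgroup n) (resGalOfEmb (closureEmb (K := ℚ) (v.adicCompletion ℚ)) g) 1 y)
                ⟨g • Q, smul_mem_localLayerPointsOfEmb κ _ W n g hQ⟩ = pair n y ⟨Q, hQ⟩) ∧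
            -- (PT) orthogonality up to `2^m` on the Kummer witnesses of `Sel⁺(E/ℚ_∞)` (Poitou–Tate along `ℚ_∞`), per layer
            (∀ (x : I.H) (t : W.subgroupH1 2 κ.kerSubgroup), t ∈ signedSelmerInfty W κ 1 →
              ∀ (φ : contOneCocycles (discreteTopRep κ.kerSubgroup (W.geomPrimaryTorsion 2)))
                (Q : localPoints W (v.adicCompletion ℚ)) (k : ℕ), oneCocycleClass _ φ = t →
                2 ^ k • Q ∈ (⨆ n, signedLocalPoints κ (v.adicCompletion ℚ) W 1 n) →
                (∀ τ : localSubgroupOfEmb κ.kerSubgroup (closureEmb (K := ℚ) (v.adicCompletion ℚ)),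
                  pointsMapOfEmb W (closureEmb (K := ℚ) (v.adicCompletion ℚ))
                      ((φ.1 (resGalSubgroupOfEmb κ.kerSubgroup _ τ) : W.geomPrimaryTorsion 2) : W.geomPoints) =
                    (τ : absoluteGaloisGroup (v.adicCompletion ℚ)) • Q - Q) →
                ∀ (n : ℕ) (hQn : 2 ^ k • Q ∈ localLayerPointsOfEmb κ (closureEmb (K := ℚ) (v.adicCompletion ℚ)) W n),
                  PadicInt.toZModPow k ((2 : ℤ_[2]) ^ m * pair n (I.proj n x) ⟨2 ^ k • Q, hQn⟩) = 0) ∧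
            -- (ES) a genuine `2`-adic Euler-system class
            Kato2004.IsEulerSystemClassTwo W hκ I s ∧
            -- (ERL♭) per layer: every functional glued from `⟨proj n s, ·⟩_n` has its ♭-Coleman values bounded by `L♭` at `𝔭`
            (∀ (z : localTowerPointsOfEmb κ (closureEmb (K := ℚ) (v.adicCompletion ℚ)) W →+ ℤ_[2]),
              (∀ (n : ℕ) (Q : localPoints W (v.adicCompletion ℚ)) (hQ : Q ∈ localLayerPointsOfEmb κ (closureEmb (K := ℚ) (v.adicCompletion ℚ)) W n),
                z ⟨Q, localLayerPointsOfEmb_le_localTowerPointsOfEmb κ _ W n hQ⟩ = pair n (I.proj n s) ⟨Q, hQ⟩) →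
              ∀ Ls Lf : IwasawaAlgebra 2, IsColemanPair κ (closureEmb (K := ℚ) (v.adicCompletion ℚ)) W 0 g d z Ls Lf →
                lengthAt (IwasawaAlgebra 2) (IwasawaAlgebra 2 ⧸ Ideal.span {Lf}) 𝔭 ≤
                  lengthAt (IwasawaAlgebra 2) (IwasawaAlgebra 2 ⧸ Ideal.span {kobayashiL 1 Lplus Lminus}) 𝔭)) :
    Summit.BirchSwinnertonDyer.BirchSwinnertonDyer.Theses.ResidualThetaTransportAtTwo.SignedKatoDivisibilityUpToAtTwo :=
  signedKatoDivisibilityUpToAtTwo_of_contraFact_of_gzk_of_layerPairings hK2 hGZK H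

end SignedKatoOffTwo.H1SideOfLayerPairings

end Summit.BirchSwinnertonDyer.BirchSwinnertonDyer.Theorems

end
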